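import Literature.IUT.HodgeTheaters.StableCurveTemperedDataOfSpecialFibreProp24PrintedOneCall
import HarnessLib

/-!
# [IUTchI] Prop. 2.4 (i) ALONE at the genuine 𝔛-datum — the (i)-side law package of the one-call, by name

Mochizuki, *Inter-universal Teichmüller theory I*, kurims manuscript (May 2020), §2, Prop. 2.4 (i) p. 50 with its
proof p. 50 l. 25–51 [cite: Mochizuki2012, Prop 2.4(i) p.50] (D-0012 claim key; nothing of the series is asserted
here); the cited inputs are [Config] Rmk. 1.2.2 (p. 50 l. 26 "[as is well-known — cf., e.g., [Config], Remark 1.2.2]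
`Δ̂_X` is strongly torsion-free"), Mochizuki, *Semi-graphs of anabelioids*, Publ. RIMS **42** (2006), Thm. 3.7 (iii)
p. 41 and Ex. 3.10 pp. 44–45 [cite: MochizukiSemiAnbd2006, Thm 3.7(iii) p.41], and Hoshi–Mochizuki [NodNon]
Lem. 1.9 (ii) as abc-iut-L3's frozen predicate `PSCDatum.VerticialIntersectionNear` (FACT-LIST F-2540)
[cite: HoshiMochizukiNodNon2011, Lem 1.9 (ii) p.291].  Pages: [IUTchI] = kurims preprint render
paper:url-690e7b3c6199 (lit/SOURCES.md §0/§11).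

PROOF-ONLY adapter (abc-iut-L5-t11 gen 8; no definition, no instance, no new `Prop` fact).  The one-call
`prop24_cor25_ofPiData_byName` (p451534) returns (i) ∧ (ii) ∧ (iii) ∧ Cor. 2.5 and therefore asks for the (ii)-side
laws (`hI`, `hRF`, `hA3ar`, per-level decomposition data) and a cusp as well.  Consumers that need ONLY
[IUTchI] Prop. 2.4 (i) at the genuine datum — the `h24i : (ofSpecialFibre …).Prop24i` binder of abc-iut-L6's
[IUTchII] Cor. 2.4 (i)′ closers at the genuine pair (abc-iut-w4-d012's `cor24_i'_ofPiCHat_of_graphTower_comap` p440067 and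
abc-iut-w6-d069's same-datum package `exists_cor24_i'_and_cor24_ii_iii'_ofPiCHat_of_graphTower_comap`), and the
layer certificates — get here the (i)-side package on its own, every law a PRINTED citation
keyed on a typed predicate of the tree, exactly as in the one-call:

* `prop24i_ofPiData_byName` — LAWS `hTF` ([Config] Rmk 1.2.2, printed form on `X.DeltaHat`) · `hNN_i` (F-2540
  `VerticialIntersectionNear` of a per-level `PSCDatum` on `Π̂_{𝔾_{J_i}}`, with the identification side conditions
  `σ`, `Λv`, `hvert`, `hΛv`, node data `src/tgt/c₁/c₂/hends/h₁/h₂/hloop`) · `hab` (pro-`Σ` abelianizations along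
  `adm_i`, p. 50 l. 33–36) · `hadm` (the admissible kernels shrink to `1`, p. 50 l. 45–49); DATA `P`
  (abc-iut-L3's origin record `SpecialFibreTower.PiData`, [SemiAnbd] Ex. 3.10); no cusp needed;
* `prop24i_and_iii_ofPiData_byName` — the same plus a cusp `x` gives (i) ∧ (iii) (abc-iut-L5-t11 gen 6
  `prop24iii_ofSpecialFibre`), still without any (ii)-side law.

CONDITIONAL, as labelled; typed ≠ discharged for the laws; `P` is origin data inhabited at model towers only
(abc-iut-L3-t2); nothing here asserts that abc is proved or refuted, and nothing here bears on [IUTchIII] Cor. 3.12.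
-/

noncomputable section

namespace Literature.IUT.HodgeTheaters

open _root_.Topology
open scoped Pointwise
open Literature.AnabelianGeometry.SemiGraphs Literature.AnabelianGeometry.SemiGraphs.ProfiniteSemiGraph

namespace StableCurveTemperedData

namespace OfSpecialFibre

variable {p : ℕ} [Fact p.Prime] (X : TemperedCurve p) (d : X.GroupLevelData)
  (T : SpecialFibreTower X.DeltaTemp)
  (Sigma SigmaHat : Set ℕ) (hsub : Sigma ⊆ SigmaHat) (hne : Set.Nonempty Sigma)
  (hprime : ∀ q ∈ SigmaHat, q.Prime)
  (S : SpecialFibreData (X.toTemperedArithmeticGroup d)) (h36 : S.Gc.Prop36Hypotheses)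
  (hp : p ∉ Sigma) (TpH : Subgroup S.chart.G)
  (HatH : Subgroup (TemperedGraphGroupData.exists_completion_of_prop36 S.Gc h36 S.chart).choose)
  (hle : TpH.map (TemperedGraphGroupData.exists_completion_of_prop36 S.Gc h36
    S.chart).choose_spec.choose.toMonoidHom ≤ HatH)
  (cuspMeetsH : {x : X.Pt // X.IsCusp x} → Prop)

/-- **[IUTchI] Prop. 2.4 (i) AS TYPED at the genuine 𝔛-datum over `P`, ALONE, every law a printed citation on a typed
predicate of the tree**: `Δ^tp_X ⊆ Δ̂_X`-side assertion "`γ·Λ·γ⁻¹ ⊆ Δ^tp_X ⟹ γ ∈ Δ^tp_X`" from [Config] Rmk 1.2.2 in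
printed form (`hTF`), Prop. 2.1 at every level graph `𝔾_{J_i}` with [SemiAnbd] Thm 3.7 (iii) a THEOREM at the finite
level fibres (`P.finite`) and (A3) := F-2540 BY NAME (`hNN`), the pro-`Σ` abelianization law along `adm_i` (`hab`),
and "the admissible kernels shrink to `1`" (`hadm`, giving (INV) by abc-iut-f-193's
`detectsTempered_ofSpecialFibre_of_admKer_nhds_one`).  No (ii)-side law, no cusp.
([IUTchI] Prop 2.4(i) p.50) [claim: Mochizuki2012, status: disputed] -/
theorem prop24i_ofPiData_byName (P : SpecialFibreTower.PiData X d S T)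
    -- [Config] Rmk 1.2.2, printed form on `X.DeltaHat`
    (hTF : ∀ H : Subgroup X.DeltaHat, IsOpen (H : Set X.DeltaHat) →
      ∀ (h : H) (n : ℕ), n ≠ 0 →
        SigmaCharDetects Set.univ H h → SigmaCharDetects Set.univ H (h ^ n))
    -- per-level PSC data with (A3) := F-2540 BY NAME and the identification side conditions
    (G : ∀ i, PSCDatum (levelGraph X T Sigma SigmaHat hsub hne hprime i).Hat)
    (hNN : ∀ i, (G i).VerticialIntersectionNear)
    (σ : ∀ i, (T.Gc i).graph.Vertex ≃ (G i).graph.V) (Λv : ∀ i, (G i).graph.V → Subgroup (T.chart i).G)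
    (hvert : ∀ i (v : (T.Gc i).graph.Vertex), Λv i (σ i v) ∈ verticialSubgroups (T.chart i) v)
    (hΛv : ∀ i v, (Λv i v).map (levelGraph X T Sigma SigmaHat hsub hne hprime i).ι = (G i).vertGp v)
    (src tgt : ∀ i, (G i).graph.N → (G i).graph.V) (c₁ c₂ : ∀ i, (G i).graph.N → (T.chart i).G)
    (hends : ∀ i e, (G i).graph.nodeEnds e = s(src i e, tgt i e))
    (h₁ : ∀ i e, (G i).nodeGp e ≤
      MulAut.conj ((levelGraph X T Sigma SigmaHat hsub hne hprime i).ι (c₁ i e)) • (G i).vertGp (src i e))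
    (h₂ : ∀ i e, (G i).nodeGp e ≤
      MulAut.conj ((levelGraph X T Sigma SigmaHat hsub hne hprime i).ι (c₂ i e)) • (G i).vertGp (tgt i e))
    (hloop : ∀ i e, src i e = tgt i e → (c₁ i e)⁻¹ * c₂ i e ∉ Λv i (src i e))
    -- the pro-`Σ` abelianization law along the admissible quotients
    (hab : ∀ (i : ℕ) (A : Type) [CommGroup A] [Finite A] (χ : T.N i →* A),
      IsOpen ((χ.ker : Subgroup (T.N i)) : Set (T.N i)) →
      (∀ q : ℕ, q.Prime → q ∣ Nat.card A → q ∈ Sigma) → (T.adm i).toMonoidHom.ker ≤ χ.ker)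
    -- the admissible kernels shrink to `1`
    (hadm : ∀ U ∈ 𝓝 (1 : ↥X.DeltaTemp), ∃ j, ((T.admKer j : Subgroup ↥X.DeltaTemp) : Set ↥X.DeltaTemp) ⊆ U) :
    (ofSpecialFibre X d S h36 Sigma SigmaHat hsub hne hprime hp TpH HatH hle cuspMeetsH).Prop24i :=
  prop24i_ofSpecialFibre_of_tower X d T Sigma SigmaHat hsub hne hprime S h36 hp TpH HatH hle cuspMeetsH P.N_cofinal
    (stronglyTorsionFreeSigma_ofSpecialFibre_of_torsionFreeAb X d Sigma SigmaHat hsub hne hprime S h36 hp TpH HatH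
      hle cuspMeetsH hTF)
    (prop21Levels_ofPiData_byName_at X d T Sigma SigmaHat hsub hne hprime S h36 hp TpH HatH hle cuspMeetsH P G hNN σ
      Λv hvert hΛv src tgt c₁ c₂ hends h₁ h₂ hloop)
    (specializationAb_ofSpecialFibre_of_characters X d T Sigma SigmaHat hsub hne hprime S h36 hp TpH HatH hle
      cuspMeetsH hab)
    (detectsTempered_ofSpecialFibre_of_admKer_nhds_one X d T Sigma SigmaHat hsub hne hprime S h36 hp TpH HatH hle
      cuspMeetsH P.N_cofinal hadm)

/-- **[IUTchI] Prop. 2.4 (i) ∧ (iii) AS TYPED at the genuine 𝔛-datum over `P` from the (i)-side package and a cusp**: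
(iii) ("`Π^tp_X` is commensurably terminal in `Π̂_X`", proof p. 51 l. 22–29 from (i) and a cusp) by abc-iut-L5-t11
gen 6's `prop24iii_ofSpecialFibre`; no (ii)-side law. ([IUTchI] Prop 2.4(iii) p.50) [claim: Mochizuki2012, status: disputed] -/
theorem prop24i_and_iii_ofPiData_byName (P : SpecialFibreTower.PiData X d S T) (x : {x : X.Pt // X.IsCusp x})
    (hTF : ∀ H : Subgroup X.DeltaHat, IsOpen (H : Set X.DeltaHat) →
      ∀ (h : H) (n : ℕ), n ≠ 0 →
        SigmaCharDetects Set.univ H h → SigmaCharDetects Set.univ H (h ^ n))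
    (G : ∀ i, PSCDatum (levelGraph X T Sigma SigmaHat hsub hne hprime i).Hat)
    (hNN : ∀ i, (G i).VerticialIntersectionNear)
    (σ : ∀ i, (T.Gc i).graph.Vertex ≃ (G i).graph.V) (Λv : ∀ i, (G i).graph.V → Subgroup (T.chart i).G)
    (hvert : ∀ i (v : (T.Gc i).graph.Vertex), Λv i (σ i v) ∈ verticialSubgroups (T.chart i) v)
    (hΛv : ∀ i v, (Λv i v).map (levelGraph X T Sigma SigmaHat hsub hne hprime i).ι = (G i).vertGp v)
    (src tgt : ∀ i, (G i).graph.N → (G i).graph.V) (c₁ c₂ : ∀ i, (G i).graph.N → (T.chart i).G)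
    (hends : ∀ i e, (G i).graph.nodeEnds e = s(src i e, tgt i e))
    (h₁ : ∀ i e, (G i).nodeGp e ≤
      MulAut.conj ((levelGraph X T Sigma SigmaHat hsub hne hprime i).ι (c₁ i e)) • (G i).vertGp (src i e))
    (h₂ : ∀ i e, (G i).nodeGp e ≤
      MulAut.conj ((levelGraph X T Sigma SigmaHat hsub hne hprime i).ι (c₂ i e)) • (G i).vertGp (tgt i e))
    (hloop : ∀ i e, src i e = tgt i e → (c₁ i e)⁻¹ * c₂ i e ∉ Λv i (src i e))
    (hab : ∀ (i : ℕ) (A : Type) [CommGroup A] [Finite A] (χ : T.N i →* A),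
      IsOpen ((χ.ker : Subgroup (T.N i)) : Set (T.N i)) →
      (∀ q : ℕ, q.Prime → q ∣ Nat.card A → q ∈ Sigma) → (T.adm i).toMonoidHom.ker ≤ χ.ker)
    (hadm : ∀ U ∈ 𝓝 (1 : ↥X.DeltaTemp), ∃ j, ((T.admKer j : Subgroup ↥X.DeltaTemp) : Set ↥X.DeltaTemp) ⊆ U) :
    (ofSpecialFibre X d S h36 Sigma SigmaHat hsub hne hprime hp TpH HatH hle cuspMeetsH).Prop24i ∧
      (ofSpecialFibre X d S h36 Sigma SigmaHat hsub hne hprime hp TpH HatH hle cuspMeetsH).Prop24iii := by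
  haveI : Nonempty X.Pt := ⟨x.1⟩
  haveI : Nonempty {x : X.Pt // X.IsCusp x} := ⟨x⟩
  have h24i : (ofSpecialFibre X d S h36 Sigma SigmaHat hsub hne hprime hp TpH HatH hle cuspMeetsH).Prop24i :=
    prop24i_ofPiData_byName X d T Sigma SigmaHat hsub hne hprime S h36 hp TpH HatH hle cuspMeetsH P hTF G hNN σ Λv
      hvert hΛv src tgt c₁ c₂ hends h₁ h₂ hloop hab hadm
  exact ⟨h24i, prop24iii_ofSpecialFibre X d S h36 Sigma SigmaHat hsub hne hprime hp TpH HatH hle cuspMeetsH x h24i⟩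

end OfSpecialFibre

end StableCurveTemperedData

end Literature.IUT.HodgeTheaters

end
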